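import HarnessLib
import Summits.QuantumFields.YangMills.Theses.BalabanLadder
import Summits.QuantumFields.YangMills.Theorems.BalabanLadderUVSeamRecStubTransport
import Summits.QuantumFields.YangMills.Theorems.BalabanLadderUVSeamRecUnitTransfer
import Summits.QuantumFields.YangMills.Theorems.BalabanLadderUVSeamRecCeilingsResponseMomentsUnit
import Summits.QuantumFields.YangMills.Theorems.BalabanLadderUVSeamRecCeilingsResponseCarriersUnit
import Summits.QuantumFields.YangMills.Theorems.BalabanLadderUVSeamRecClassicalResponseTempering
import Literature.MathematicalPhysics.QuantumLattice.RepLieAlgebraUnitary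

/-! # LINE «af-carrier» (asymptotically-free carrier) for crux `UVSeamRec` (stmt-QuantumFields-20043) — ideator ym-idea-10 g2 (lens RESCUER), 2026-08-28

A RESCUED skeleton (crux workfile, not a registry write; the owner's pen decides).  CORPSES: every (β)-architecture candidate of this crux —
v6(β-cl), v7c (WCL), v8c (UCR), v8d (GUCR), and ideator g0's `coldwall_pure` ∕ `guarded_classical_gap` — carries the SAME second measure-side stub
`stub_gaussianDomination : ClassicalResponse.GaussianDominationSU2` («extensive sub-Gaussian law, with β-UNIFORM constants `(m₁, v₁)`, of the linear
statistic `ℓ = √(carrierCl rF 1 1 β R q x)`, i.e. of `√β·R²·√(classical centre response)`, on the femto window `R·uRec β ≤ ℓ₁`»).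

LOCATED DEATH K6 «BARE-COUPLING CARRIER» (this line's diagnosis; heuristic, one-loop, background-field gauge).  The carrier of record multiplies the
β-free classical response by the BARE coupling `β = 4/g₀²`.  Under the torus state the law of a smooth scale-`R` background is governed by the
EFFECTIVE action `Γ_R[B] ≈ (β_eff(R)/β)·β·S_W[B]` with the one-loop running `β_eff(R) = β − 4b₀·log R·(4π²…)⁻¹ ≍ (11/(3π²))·log(1/(R·uRec β))`
(asymptotic freedom read at scale `R`: Creutz ratios ∕ the static force at distance `R` are governed by `g²(R)`, not `g₀²`).  Hence
`E_T ℓ² = β·R⁴·E_T[resp_cl] ≍ c·β/β_eff(R) = c·g²(R)/g₀²`, and at the TOP of the window `R = ℓ₁/uRec β` this is `(β/4)·g²_phys(ℓ₁) → ∞` LINEARLY in `β`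
for EVERY fixed `ℓ₁ > 0`.  Since `EMLin 1 β₁ ℓ₁ m₁ v₁` forces `E_T ℓ² ≤ v₁ + m₁²` (expand at `t → 0`), `GaussianDominationSU2` is FALSE as typed, and
so is the older (EC) «exponential moments of the bare carrier».  The Gaussian calibration (seam-s2 `GaussianCalibration*`: (GD) holds for the lattice
GFF with `v₁` = an operator norm) cannot see K6: a free field does not run.  (The split stubs are NOT hit: a bare-β carrier only ENLARGES their
right-hand side; the (RM) currency is not hit: it is in response units, `(R⁴/C₁)|g| ≍ g²(R)/C₁ ≤ g²(ℓ₁)/C₁`.)  INSTRUMENT ROW (refutes∕confirms K6 and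
decides this line's second stub): under the torus state at `β_std ∈ {2.5, 2.7, 2.85}`, `L = 24…32`, measure `⟨β·R⁴·classicalResponse⟩` and
`Var(√(β R⁴ classicalResponse))` for `R = 2…6` (classical response = a deterministic Dirichlet minimisation per sampled exterior): K6 predicts growth
`∝ 1/(1 − (11/(6π²))·(4/β)·log R)` (≈ +15–35 % per doubling of `R` at these β); β-cl of record predicts a plateau.

THE DODGE (minimal variation of the (β) architecture that survives K6): replace the bare coefficient `β` of the carrier by the RUNNING one,
`bAF β R := 1 + |log(R·uRec β)|` (`= 1 + log(1/(R·uRec β))` on the window; `≍ β` at `R = 1`, `≍ log(1/ℓ₁)` at the top; any function squeezed between two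
multiples of the one-loop `β_eff(R)` would do — this representative is typed over the tree's `carrierCl` by evaluating its β-slot at `bAF β R`).  Two
measure-side stubs, reference-honest (K2: `p q β` ∃-quantified, β-dependent) and exterior-honest (K4/K5: no rarity clause, coherent flux is PAID):
* `stub_splitAF` — «quantum response ≤ A₀ + running-coupling × classical response», pure (flag-free), for EVERY exterior, on the window.  It is HARDER
  than β-cl's split exactly by the factor K6 removes from the other side (conservation of difficulty, stated openly): for a coherent exterior the quantum
  response `≈` the classical one, so the stub needs `C_s ≤ C₁·(1 + log(1/ℓ₁))` — available because `bAF ≥ 1 + log(1/ℓ₁)` on the window.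
* `stub_carrierMomentsAF` — «joint exponential moments of the AF carrier at coefficient one» on every odd torus and cyclically separated family: the
  effective Boltzmann weight of scale-`R` backgrounds is `exp(−β_eff(R)·S)`, and `bAF/β_eff(R)` is BOUNDED on the window, so `exp(Σ Q^AF_i/C₀)` is a
  Gaussian-type exponential moment at the CORRECT temperature (one cube: finite for `C₀` large; extensivity over `2R+4`-separated families = almost-
  orthogonality of the harmonic centre functionals, as in (GD)).
* `stub_floorsEngine` — BYTE-IDENTICAL to v5(α)/v7c/v8c/v8d/coldwall_pure (the NT desk's engine, 19353); not rescued here.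
TRUTH-IN-LABELLING (K1, as g0): the measure-side stubs are stated WITHOUT the idle `UV →`; `UVSeamRec_of` still concludes `UV → …` by name.

THEOREMS of the skeleton (kernel-checked): `responseMomentsOdd6SU2_of_AF` ((split^AF) ∧ (EC^AF) ⇒ the registered v5(α) (RM) body, via the landed
press-button `TemperedResponse.responseMomentsOdd6_of_carriers` with ONE carrier, after rescaling the split from `C_s` and the moments from `C₀` to
`C := max C_s C₀`), `stub_responseMomentsOdd6` (registered text verbatim), `stub_ceilings`, `stub_transport`, `UVSeamRec_of`.
Stubs (sorries) = {`stub_splitAF`, `stub_carrierMomentsAF`, `stub_floorsEngine`}.  bears_on: LADDER-YM rung R2d (E0′ ceilings at SU(2)).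

HONEST FRAMING: a re-cut of OPEN conditional content plus kernel-checked glue; K6 is a heuristic diagnosis with a stated instrument, not a theorem;
nothing of E0′, NT or a gap is claimed; not Clay; no summit is proved by a line.
-/

namespace Summit.QuantumFields.YangMills.Cruxes.UVSeamRec.AFCarrier

open Literature.MathematicalPhysics.QuantumFieldTheory
open Summit.QuantumFields.YangMills.Cruxes.OSLegsFromFemtoAndGap.DlrCollarTransfer
open Filter Topology
open scoped SchwartzMap
open Literature.MathematicalPhysics.QuantumLattice (thetaTest LGConfig fundamentalLatticeRep)
open Summit.QuantumFields.YangMills.Cruxes.UVSeamRec.ClassicalResponse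
  (carrierCl carrierCl_eq_mul carrierCl_nonneg measurable_carrierCl abs_carrierCl_le)

/-- The FUNDAMENTAL (defining) lattice representation of `SU(2)` (as v4-F/v5(α)). -/
abbrev rF : LatticeRep (Matrix.specialUnitaryGroup (Fin 2) ℂ) :=
  Literature.MathematicalPhysics.QuantumLattice.fundamentalLatticeRep 2

/-- the unit of record (abbreviation used only inside this skeleton). -/
noncomputable abbrev uRec : ℝ → ℝ := fun β => Real.exp (Summit.QuantumFields.YangMills.Theorems.FemtoTransferGap.sizeLog β 1)

/-- The ASYMPTOTICALLY-FREE carrier coefficient: `1 + |log(R·uRec β)|` — on the femto window (`R·uRec β ≤ ℓ₁ < 1`) this is `1 + log(1/(R·uRec β))`,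
a representative of the one-loop running coupling `β_eff(R) ≍ log(ξ_lat(β)/R)` read at the cube scale `R` (at `R = 1` it is `≍ β`; at the top of the
window it is `≍ log(1/ℓ₁)`, β-free).  It replaces the BARE `β` in the β-slot of `ClassicalResponse.carrierCl`. -/
noncomputable def bAF (β : ℝ) (R : ℕ) : ℝ := 1 + |Real.log ((R : ℝ) * Transport.uRec β)|

theorem one_le_bAF (β : ℝ) (R : ℕ) : 1 ≤ bAF β R := le_add_of_nonneg_right (abs_nonneg _)

theorem bAF_pos (β : ℝ) (R : ℕ) : 0 < bAF β R := lt_of_lt_of_le one_pos (one_le_bAF β R)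

/-- D0 (iso-transport) — PROVED (`Transport.stub_transport_proved`, p412513); text = v5(α) verbatim. -/
theorem stub_transport :
    (letI : MeasurableSpace (Matrix.specialUnitaryGroup (Fin 2) ℂ) := borel _
     haveI : BorelSpace (Matrix.specialUnitaryGroup (Fin 2) ℂ) := ⟨rfl⟩
     ∃ r₂ : LatticeRep (Matrix.specialUnitaryGroup (Fin 2) ℂ),
       LowerBounds (Matrix.specialUnitaryGroup (Fin 2) ℂ) r₂ uRec ∧ MomentBounds6 (Matrix.specialUnitaryGroup (Fin 2) ℂ) r₂ uRec) →
    ∀ (G : Type) [Group G] [TopologicalSpace G] [IsTopologicalGroup G] [CompactSpace G],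
      IsCompactSimpleLieGroup G → Nonempty (G ≃ₜ* Matrix.specialUnitaryGroup (Fin 2) ℂ) →
      letI : MeasurableSpace G := borel G; haveI : BorelSpace G := ⟨rfl⟩;
      ∃ r : LatticeRep G, LowerBounds G r uRec ∧ MomentBounds6 G r uRec := by
  exact Summit.QuantumFields.YangMills.Cruxes.UVSeamRec.Transport.stub_transport_proved

/-- STUB (split^AF) «RUNNING-COUPLING CLASSICAL SPLIT, pure, on the window» (XL; HARDEST): constants `C_s, C₁ > 0`, `A₀ ≥ 0`, `ℓ₁ > 0`, bounded β-DEPENDENT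
reference values `p q β` (K2-honest: the thermal floor pins `p = 2 − Θ(1/β)`, it cannot refute an ∃-quantified `p`; `not_pureSplitCl_const_two` is
honoured because `p` is not the constant `2`), and a threshold `β₁` such that for `β ≥ β₁`, `1 ≤ R`, `R·uRec β ≤ ℓ₁`, every plane, site and EVERY
exterior `η`: `(R⁴/C₁)|kerE^η(plane q x) − p q β| ≤ A₀ + carrierCl rF C_s 1 (bAF β R) R q x η` — quantum response ≤ `A₀` + RUNNING coupling × `R⁴` ×
classical response.  No rarity clause (K4/K5 cannot bite: a penetrating ∕ coherent exterior has classical response `≍ R⁻⁴·(flux)²` and is PAID, with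
room exactly `bAF·C₁/C_s ≥ 1`).  Fixed-scale rung: at every FIXED `R` the cold-wall-referenced split holds for all η with SOME constant
(`ClassicalResponse.pureSplit_fixedScale_coldWall`, p594071) and `bAF ≥ 1`, so only the onset UNIFORM on the window is open.  Gaussian calibration: for the
lattice GFF quantum response = classical response identically (seam-s2 `GaussianCalibrationSplit`), so the stub holds there with `C_s = C₁`, `A₀` = the
Dirichlet rate constant.  Why it might fail: it is β-cl's (split-cl) with the slack factor `β/β_eff(R)` REMOVED — a background-dependent one-loop remainder
of ONE Dirichlet cube kernel that is not bounded by `log(1/(R·uRec β))·R⁴ ×` classical response uniformly on the window (e.g. a term linear in the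
background flux with an `R`-growing coefficient) kills it; AM-GM leaves room only for terms quadratic in the background.  INSTRUMENT: cold-wall vs.
fluxed-wall boxes at β_std 2.5–3.0, `R = 1..4`: ratio (quantum response)/(R⁴·classical response) against `1 + log(1/(R·uRec β))`. -/
theorem stub_splitAF :
    ∃ (C_s C₁ A₀ P₀ β₁ ℓ₁ : ℝ) (p : Fin 4 × Fin 4 → ℝ → ℝ), 0 < C_s ∧ 0 < C₁ ∧ 0 ≤ A₀ ∧ 0 < ℓ₁ ∧ (∀ q β, |p q β| ≤ P₀) ∧
      ∀ β : ℝ, β₁ ≤ β → ∀ R : ℕ, 1 ≤ R → (R : ℝ) * Transport.uRec β ≤ ℓ₁ →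
      ∀ (q : Fin 4 × Fin 4) (x : Fin 4 → ℤ), q.1 < q.2 → ∀ η : LGConfig 4 (Matrix.specialUnitaryGroup (Fin 2) ℂ),
        (R : ℝ) ^ 4 / C₁ * |kerE (Matrix.specialUnitaryGroup (Fin 2) ℂ) (fundamentalLatticeRep 2) β (fun k => x k - (R + 1)) (2 * R + 3) η
            (plane (Matrix.specialUnitaryGroup (Fin 2) ℂ) (fundamentalLatticeRep 2) q x) - p q β| ≤
          A₀ + carrierCl (fundamentalLatticeRep 2) C_s 1 (bAF β R) R q x η := by
  sorry

/-- STUB (EC^AF) «JOINT EXPONENTIAL MOMENTS OF THE ASYMPTOTICALLY-FREE CARRIER at coefficient one» (XL): a carrier constant `C₀ > 0`, `ℓ₂ > 0`, `B`, `β₂`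
such that for `β ≥ β₂`, every odd torus `2L+1` with `4R+8 ≤ L`, every cyclically `2R+4`-separated family on the window `R·uRec β ≤ ℓ₂` and every
sub-family `T`: `⟨exp(Σ_{i∈T} carrierCl rF C₀ 1 (bAF β R) R (q i) (x i))⟩_{2L+1,β} ≤ exp(B·#T)`.  This is the (EC)/(GD) organ of every (β) corpse with the
bare `β` replaced by the running `bAF β R` — the ONLY coefficient for which the statement is consistent with asymptotic freedom (K6: with the bare `β`
already the MEAN `⟨β R⁴ classicalResponse⟩_T ≍ β/β_eff(R)` is unbounded at the top of the window).  Heuristic: the law of scale-`R` backgrounds under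
the torus state is `∝ exp(−β_eff(R)·S_W)`, `bAF/β_eff(R)` is bounded on the window, classical response `≤` (harmonic centre flux)², so one cube is a Gaussian
exponential moment at the correct temperature (finite for `C₀` large) and separated families factorise up to the almost-orthogonality of the harmonic
centre functionals (dipole kernels `≍ d⁻⁴`, summable in `d = 4` only against the `R⁴` normalisation — the same bet as (GD)).  Gaussian calibration: for
the GFF `bAF` may be replaced by any constant and the stub is seam-s2's `GaussianCalibrationLaw` (PROVED).  Semiclassical consistency: torons ∕ constant
non-abelian modes of amplitude `(βL⁴)^{-1/4}` give carrier `≲ bAF·(R/L)⁴·√β… → 0`; instantons of size `ρ ≥ R` have classical response `≍ R⁴ρ⁴/(ρ²+R²)⁴`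
and density `∝ (ρ·uRec β)^{22/3}ρ⁻⁵dρ`, β-free at the top of the window and paid by `bAF ≍ log(1/ℓ₂)` — finite.  Why it might fail: it is a UV-stability
statement of E0′ type for a boundary-flux statistic, uniform in the torus size, whose only proof route known is a Bałaban-type block renormalisation
down to scale `R` (the running coupling must be PRODUCED, not posited); non-Gaussian large-field contributions at intermediate scales could make the
exponential (rather than polynomial) moment infinite for every `C₀`.  INSTRUMENT: the K6 row above (growth law of `⟨β R⁴ classicalResponse⟩_T` in `R`)
plus the single-cube exponential moment at `R = 4`, β_std = 2.7 for `C₀ ∈ {1, 4, 16}`. -/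
theorem stub_carrierMomentsAF :
    letI : MeasurableSpace (Matrix.specialUnitaryGroup (Fin 2) ℂ) := borel _
    haveI : BorelSpace (Matrix.specialUnitaryGroup (Fin 2) ℂ) := ⟨rfl⟩
    ∃ (C₀ B β₂ ℓ₂ : ℝ), 0 < C₀ ∧ 0 < ℓ₂ ∧
      ∀ β : ℝ, β₂ ≤ β → ∀ (L n : ℕ) (q : Fin n → Fin 4 × Fin 4) (x : Fin n → (Fin 4 → ℤ)) (R : ℕ),
      (∀ i, (q i).1 < (q i).2) → 1 ≤ R → (R : ℝ) * Transport.uRec β ≤ ℓ₂ → 4 * R + 8 ≤ L →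
      (∀ i j : Fin n, i ≠ j → ∃ k : Fin 4,
        (2 * (R : ℤ) + 4) ≤ |((((x i k - x j k : ℤ) : ZMod (2 * L + 1))).valMinAbs : ℤ)|) →
      ∀ T : Finset (Fin n),
        torusE (Matrix.specialUnitaryGroup (Fin 2) ℂ) (fundamentalLatticeRep 2) β L
          (fun U => Real.exp (∑ i ∈ T, carrierCl (fundamentalLatticeRep 2) C₀ 1 (bAF β R) R (q i) (x i) U)) ≤ Real.exp (B * T.card) := by
  sorry

/-- GLUE (proved here): (split^AF) ∧ (EC^AF) ⇒ the registered v5(α) (RM) body.  Mechanism: `C := max C_s C₀`; the split rescales UP from `C_s` to `C`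
(`C₁ ↦ C₁·C/C_s`, `carrierCl_eq_mul`), the moments rescale DOWN from `C₀` to `C` (the carrier is inversely proportional to its constant and non-negative,
`torusE` is monotone); then the landed press-button `TemperedResponse.responseMomentsOdd6_of_carriers` with ONE carrier `Y := carrierCl rF C 1 (bAF β R) R`
(measurable, bounded by `|bAF β R|·R⁴/|C|·2N`), unit `a := uRec`, `c := 1`, `β₁ := max β₁ β₂`, `ℓ₁ := min ℓ₁ ℓ₂`. -/
theorem responseMomentsOdd6SU2_of_AF
    (hS : ∃ (C_s C₁ A₀ P₀ β₁ ℓ₁ : ℝ) (p : Fin 4 × Fin 4 → ℝ → ℝ), 0 < C_s ∧ 0 < C₁ ∧ 0 ≤ A₀ ∧ 0 < ℓ₁ ∧ (∀ q β, |p q β| ≤ P₀) ∧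
      ∀ β : ℝ, β₁ ≤ β → ∀ R : ℕ, 1 ≤ R → (R : ℝ) * Transport.uRec β ≤ ℓ₁ →
      ∀ (q : Fin 4 × Fin 4) (x : Fin 4 → ℤ), q.1 < q.2 → ∀ η : LGConfig 4 (Matrix.specialUnitaryGroup (Fin 2) ℂ),
        (R : ℝ) ^ 4 / C₁ * |kerE (Matrix.specialUnitaryGroup (Fin 2) ℂ) (fundamentalLatticeRep 2) β (fun k => x k - (R + 1)) (2 * R + 3) η
            (plane (Matrix.specialUnitaryGroup (Fin 2) ℂ) (fundamentalLatticeRep 2) q x) - p q β| ≤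
          A₀ + carrierCl (fundamentalLatticeRep 2) C_s 1 (bAF β R) R q x η)
    (hM : letI : MeasurableSpace (Matrix.specialUnitaryGroup (Fin 2) ℂ) := borel _
      haveI : BorelSpace (Matrix.specialUnitaryGroup (Fin 2) ℂ) := ⟨rfl⟩
      ∃ (C₀ B β₂ ℓ₂ : ℝ), 0 < C₀ ∧ 0 < ℓ₂ ∧
      ∀ β : ℝ, β₂ ≤ β → ∀ (L n : ℕ) (q : Fin n → Fin 4 × Fin 4) (x : Fin n → (Fin 4 → ℤ)) (R : ℕ),
      (∀ i, (q i).1 < (q i).2) → 1 ≤ R → (R : ℝ) * Transport.uRec β ≤ ℓ₂ → 4 * R + 8 ≤ L →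
      (∀ i j : Fin n, i ≠ j → ∃ k : Fin 4,
        (2 * (R : ℤ) + 4) ≤ |((((x i k - x j k : ℤ) : ZMod (2 * L + 1))).valMinAbs : ℤ)|) →
      ∀ T : Finset (Fin n),
        torusE (Matrix.specialUnitaryGroup (Fin 2) ℂ) (fundamentalLatticeRep 2) β L
          (fun U => Real.exp (∑ i ∈ T, carrierCl (fundamentalLatticeRep 2) C₀ 1 (bAF β R) R (q i) (x i) U)) ≤ Real.exp (B * T.card)) :
    letI : MeasurableSpace (Matrix.specialUnitaryGroup (Fin 2) ℂ) := borel _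
    haveI : BorelSpace (Matrix.specialUnitaryGroup (Fin 2) ℂ) := ⟨rfl⟩
    ∃ (a : ℝ → ℝ) (c : ℝ) (C₁ B β₁ ℓ₁ P₀ : ℝ) (p : Fin 4 × Fin 4 → ℝ → ℝ), 0 < c ∧
      (∀ᶠ β in atTop, a β ≤ c * Transport.uRec β) ∧ 0 < ℓ₁ ∧ 0 < C₁ ∧ (∀ q β, |p q β| ≤ P₀) ∧
      ∀ β : ℝ, β₁ ≤ β → ∀ (L n : ℕ) (q : Fin n → Fin 4 × Fin 4) (x : Fin n → (Fin 4 → ℤ)) (R : ℕ),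
        (∀ i, (q i).1 < (q i).2) → 1 ≤ R → (R : ℝ) * a β ≤ ℓ₁ → 4 * R + 8 ≤ L →
        (∀ i j : Fin n, i ≠ j → ∃ k : Fin 4,
          (2 * (R : ℤ) + 4) ≤ |((((x i k - x j k : ℤ) : ZMod (2 * L + 1))).valMinAbs : ℤ)|) →
        ∀ T : Finset (Fin n),
          torusE (Matrix.specialUnitaryGroup (Fin 2) ℂ) (fundamentalLatticeRep 2) β L
            (fun U => Real.exp (∑ i ∈ T, (R : ℝ) ^ 4 / C₁ *
              |kerE (Matrix.specialUnitaryGroup (Fin 2) ℂ) (fundamentalLatticeRep 2) β (fun k => x i k - (R + 1)) (2 * R + 3) U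
                (plane (Matrix.specialUnitaryGroup (Fin 2) ℂ) (fundamentalLatticeRep 2) (q i) (x i)) - p (q i) β|)) ≤ Real.exp (B * T.card) := by
  letI : MeasurableSpace (Matrix.specialUnitaryGroup (Fin 2) ℂ) := borel _
  haveI : BorelSpace (Matrix.specialUnitaryGroup (Fin 2) ℂ) := ⟨rfl⟩
  obtain ⟨C_s, C₁, A₀, P₀, β₁, ℓ₁, p, hCs, hC₁, hA₀, hℓ₁, hp, hsplit⟩ := hS
  obtain ⟨C₀, B, β₂, ℓ₂, hC₀, hℓ₂, hEM⟩ := hM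
  set C : ℝ := max C_s C₀ with hCdef
  have hCsC : C_s ≤ C := le_max_left _ _
  have hC₀C : C₀ ≤ C := le_max_right _ _
  have hCpos : 0 < C := hCs.trans_le hCsC
  refine Summit.QuantumFields.YangMills.Cruxes.UVSeamRec.TemperedResponse.responseMomentsOdd6_of_carriers (K := 1) one_pos
    (a := Transport.uRec) (c := 1) (C₁ := C₁ * C / C_s) (β₁ := max β₁ β₂) (ℓ₁ := min ℓ₁ ℓ₂) (A₀ := A₀) (B' := B) (P₀ := P₀) (p := p)
    one_pos (Filter.Eventually.of_forall fun β => by rw [one_mul]) (lt_min hℓ₁ hℓ₂) (by positivity) hp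
    (fun _ β R q x η => carrierCl (fundamentalLatticeRep 2) C 1 (bAF β R) R q x η)
    (fun β R => |bAF β R| * (R : ℝ) ^ 4 / |C| * (2 * (rF).N))
    (fun _ β R q x => measurable_carrierCl (r := rF) C 1 (bAF β R) R q x)
    (fun _ β R q x η => abs_carrierCl_le (r := rF) C one_pos (bAF β R) R q x η) ?_ ?_
  · -- (split^AF), rescaled from `C_s` up to `C`
    intro β hβ R hR hRa q x hq η
    have h1 := hsplit β ((le_max_left _ _).trans hβ) R hR (hRa.trans (min_le_left _ _)) q x hq η
    rw [Fin.sum_univ_one]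
    set E : ℝ := |kerE (Matrix.specialUnitaryGroup (Fin 2) ℂ) (fundamentalLatticeRep 2) β (fun k => x k - (R + 1)) (2 * R + 3) η
            (plane (Matrix.specialUnitaryGroup (Fin 2) ℂ) (fundamentalLatticeRep 2) q x) - p q β| with hE
    set Q : ℝ := carrierCl (fundamentalLatticeRep 2) C 1 (bAF β R) R q x η with hQ
    have hE0 : 0 ≤ E := abs_nonneg _
    have hQ0 : 0 ≤ Q := carrierCl_nonneg (r := rF) hCpos one_pos (bAF_pos β R).le R q x η
    rw [carrierCl_eq_mul (fundamentalLatticeRep 2) C C_s 1 (bAF β R) hCpos.ne' R q x η] at h1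
    -- h1 : R^4/C₁ * E ≤ A₀ + C/C_s * Q
    have hr0 : 0 < C_s / C := div_pos hCs hCpos
    have hr1 : C_s / C ≤ 1 := (div_le_one hCpos).2 hCsC
    have h2 := mul_le_mul_of_nonneg_left h1 hr0.le
    have e1 : C_s / C * ((R : ℝ) ^ 4 / C₁ * E) = (R : ℝ) ^ 4 / (C₁ * C / C_s) * E := by
      field_simp
    have e2 : C_s / C * (A₀ + C / C_s * Q) = C_s / C * A₀ + Q := by
      field_simp
    rw [e1, e2] at h2
    have h3 : C_s / C * A₀ ≤ A₀ := mul_le_of_le_one_left hA₀ hr1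
    linarith
  · -- (EC^AF), rescaled from `C₀` down to `C`
    intro _ β hβ L n q x R hq hR hRa hL hsep T
    have h1 := hEM β ((le_max_right _ _).trans hβ) L n q x R hq hR (hRa.trans (min_le_right _ _)) hL hsep T
    simp only [Nat.cast_one, one_mul]
    refine le_trans ?_ h1
    have hr1 : C₀ / C ≤ 1 := (div_le_one hCpos).2 hC₀C
    refine Summit.QuantumFields.YangMills.Cruxes.UVSeamRec.PolymerData.torusE_mono_of_measurable (fundamentalLatticeRep 2) β L
      (c := Real.exp (T.card * (|bAF β R| * (R : ℝ) ^ 4 / |C₀| * (2 * (rF).N))))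
      (fun η => (Real.exp_pos _).le) ?_ ?_ ?_
    · exact (Finset.measurable_sum T fun i _ => measurable_carrierCl (r := rF) C₀ 1 (bAF β R) R (q i) (x i)).exp
    · intro η
      rw [abs_of_pos (Real.exp_pos _), Real.exp_le_exp]
      calc ∑ i ∈ T, carrierCl (fundamentalLatticeRep 2) C₀ 1 (bAF β R) R (q i) (x i) η
          ≤ ∑ _i ∈ T, |bAF β R| * (R : ℝ) ^ 4 / |C₀| * (2 * (rF).N) :=
            Finset.sum_le_sum fun i _ => (le_abs_self _).trans (abs_carrierCl_le (r := rF) C₀ one_pos (bAF β R) R (q i) (x i) η)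
        _ = T.card * (|bAF β R| * (R : ℝ) ^ 4 / |C₀| * (2 * (rF).N)) := by
            rw [Finset.sum_const, nsmul_eq_mul]
    · intro η
      refine Real.exp_le_exp.2 (Finset.sum_le_sum fun i _ => ?_)
      rw [carrierCl_eq_mul (fundamentalLatticeRep 2) C₀ C 1 (bAF β R) hC₀.ne' R (q i) (x i) η]
      exact mul_le_of_le_one_left (carrierCl_nonneg (r := rF) hC₀ one_pos (bAF_pos β R).le R (q i) (x i) η) hr1

/-- (RM) — a THEOREM of the skeleton: the registered v5(α) text of `stub_responseMomentsOdd6` VERBATIM (`UV →` kept because it is the registered text;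
the hypothesis is not consumed), from (split^AF) ∧ (EC^AF) through `responseMomentsOdd6SU2_of_AF`. -/
theorem stub_responseMomentsOdd6 :
    Summit.QuantumFields.YangMills.Theses.BalabanLadder.UV →
      letI : MeasurableSpace (Matrix.specialUnitaryGroup (Fin 2) ℂ) := borel _
      haveI : BorelSpace (Matrix.specialUnitaryGroup (Fin 2) ℂ) := ⟨rfl⟩
      ∃ (a : ℝ → ℝ) (c : ℝ) (C₁ B β₁ ℓ₁ P₀ : ℝ) (p : Fin 4 × Fin 4 → ℝ → ℝ), 0 < c ∧
      (∀ᶠ β in atTop, a β ≤ c * Transport.uRec β) ∧ 0 < ℓ₁ ∧ 0 < C₁ ∧ (∀ q β, |p q β| ≤ P₀) ∧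
      ∀ β : ℝ, β₁ ≤ β → ∀ (L n : ℕ) (q : Fin n → Fin 4 × Fin 4) (x : Fin n → (Fin 4 → ℤ)) (R : ℕ),
      (∀ i, (q i).1 < (q i).2) → 1 ≤ R → (R : ℝ) * a β ≤ ℓ₁ → 4 * R + 8 ≤ L →
      (∀ i j : Fin n, i ≠ j → ∃ k : Fin 4,
      (2 * (R : ℤ) + 4) ≤ |((((x i k - x j k : ℤ) : ZMod (2 * L + 1))).valMinAbs : ℤ)|) →
      ∀ T : Finset (Fin n),
      torusE (Matrix.specialUnitaryGroup (Fin 2) ℂ) (Literature.MathematicalPhysics.QuantumLattice.fundamentalLatticeRep 2) β L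
      (fun U => Real.exp (∑ i ∈ T, (R : ℝ) ^ 4 / C₁ *
      |kerE (Matrix.specialUnitaryGroup (Fin 2) ℂ) (Literature.MathematicalPhysics.QuantumLattice.fundamentalLatticeRep 2) β
      (fun k => x i k - (R + 1)) (2 * R + 3) U
      (plane (Matrix.specialUnitaryGroup (Fin 2) ℂ) (Literature.MathematicalPhysics.QuantumLattice.fundamentalLatticeRep 2) (q i) (x i)) -
      p (q i) β|)) ≤ Real.exp (B * T.card) :=
  fun _ => responseMomentsOdd6SU2_of_AF stub_splitAF stub_carrierMomentsAF

/-- E0′ ceilings — a THEOREM of the skeleton (as v5(α)): (RM) through the landed press-button `TemperedResponse.stubCeilings_of_responseMoments`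
(p532738).  Statement = v4-F's `stub_ceilings` VERBATIM. -/
theorem stub_ceilings :
    Summit.QuantumFields.YangMills.Theses.BalabanLadder.UV →
      letI : MeasurableSpace (Matrix.specialUnitaryGroup (Fin 2) ℂ) := borel _
      haveI : BorelSpace (Matrix.specialUnitaryGroup (Fin 2) ℂ) := ⟨rfl⟩
      MomentBounds6 (Matrix.specialUnitaryGroup (Fin 2) ℂ) rF uRec :=
  fun hUV => Summit.QuantumFields.YangMills.Cruxes.UVSeamRec.TemperedResponse.stubCeilings_of_responseMoments
    (stub_responseMomentsOdd6 hUV)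

/-- STUB F-B∧F-C «compact-witness floors at an asymptotically-two-loop engine unit» (XL; NO `UV`; BYTE-IDENTICAL to v5(α)/v7c/v8c/v8d/coldwall_pure; = the engine
data of the landed per-representation transfer `UnitTransfer.lowerBounds_uRec_of_engine rF`, p441552): the FUNDAMENTAL representation `rF` of `SU(2)` and
a unit map `a` with `a β / uRec β → c₀ > 0` carrying the `Q2`/`Q3` floors with COMPACTLY SUPPORTED witnesses.  Supplier: the NT line's conditional femto
package at `SU(2)`-fundamental (19353 `stub_cfp : CFP` engine E1–E3; landed discharge `FloorsEngineOfWindow.floorsEngine_of_fcp_commensurable rF a …`,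
p448741).  NOT rescued by this line (its rescue is a line on 19353).  Why it might fail: as NT (19353) — a β-uniform floor is dimensional transmutation
(barrier PerturbativeInvisibility) — plus the scaling of the non-perturbative unit (Patrascioiu–Seiler vs. consensus). -/
theorem stub_floorsEngine :
    letI : MeasurableSpace (Matrix.specialUnitaryGroup (Fin 2) ℂ) := borel _
    haveI : BorelSpace (Matrix.specialUnitaryGroup (Fin 2) ℂ) := ⟨rfl⟩
    ∃ (a : ℝ → ℝ) (c₀ : ℝ), 0 < c₀ ∧ (∀ β, 0 < a β) ∧
      Tendsto (fun β => a β / uRec β) atTop (𝓝 c₀) ∧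
      (∃ (v : 𝓢(EuclideanSpace ℝ (Fin 4), ℝ)) (ε β₅ Λ₅ : ℝ),
        HasCompactSupport (v : EuclideanSpace ℝ (Fin 4) → ℝ) ∧
        tsupport (v : EuclideanSpace ℝ (Fin 4) → ℝ) ⊆ {y : EuclideanSpace ℝ (Fin 4) | 0 < y 0} ∧ 0 < ε ∧
        ∀ β : ℝ, β₅ ≤ β → ∀ L : ℕ, Λ₅ ≤ a β * L →
          ε ≤ Q2 (Matrix.specialUnitaryGroup (Fin 2) ℂ) rF β L (a β) (thetaTest 4 v) v) ∧
      (∃ (f g h : 𝓢(EuclideanSpace ℝ (Fin 4), ℝ)) (ε β₅ Λ₅ : ℝ),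
        HasCompactSupport (f : EuclideanSpace ℝ (Fin 4) → ℝ) ∧
        HasCompactSupport (g : EuclideanSpace ℝ (Fin 4) → ℝ) ∧
        HasCompactSupport (h : EuclideanSpace ℝ (Fin 4) → ℝ) ∧
        Disjoint (tsupport (f : EuclideanSpace ℝ (Fin 4) → ℝ)) (tsupport (g : EuclideanSpace ℝ (Fin 4) → ℝ)) ∧
        Disjoint (tsupport (g : EuclideanSpace ℝ (Fin 4) → ℝ)) (tsupport (h : EuclideanSpace ℝ (Fin 4) → ℝ)) ∧
        Disjoint (tsupport (f : EuclideanSpace ℝ (Fin 4) → ℝ)) (tsupport (h : EuclideanSpace ℝ (Fin 4) → ℝ)) ∧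
        0 < ε ∧ ∀ β : ℝ, β₅ ≤ β → ∀ L : ℕ, Λ₅ ≤ a β * L →
          ε ≤ |Q3 (Matrix.specialUnitaryGroup (Fin 2) ℂ) rF β L (a β) f g h|) := by
  sorry

/-- COMPOSITION (kernel-checked, closed form): ceilings ⊕ engine floors ⊕ LANDED unit transfer ⊕ transport ⇒ the item BY NAME. -/
theorem UVSeamRec_of : Summit.QuantumFields.YangMills.Theses.BalabanLadder.UVSeamRec := by
  intro hUV G _ _ _ _ hG hcl
  letI : MeasurableSpace (Matrix.specialUnitaryGroup (Fin 2) ℂ) := borel _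
  haveI : BorelSpace (Matrix.specialUnitaryGroup (Fin 2) ℂ) := ⟨rfl⟩
  have hc := stub_ceilings hUV
  obtain ⟨a, c₀, hc₀, ha, hau, h2, h3⟩ := stub_floorsEngine
  have hlb := Summit.QuantumFields.YangMills.Cruxes.UVSeamRec.UnitTransfer.lowerBounds_uRec_of_engine rF hc₀ ha hau hc h2 h3
  exact stub_transport ⟨rF, hlb, hc⟩ G hG hcl

end Summit.QuantumFields.YangMills.Cruxes.UVSeamRec.AFCarrier
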